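import Summits.BirchSwinnertonDyer.BirchSwinnertonDyer.Theorems.KatoDescentTamePotSupersingularJetchevIrreducibleSwapNodeTwoGuard
import Summits.BirchSwinnertonDyer.BirchSwinnertonDyer.Theorems.TameQuarticManinParityTprimeHeegnerUpperOfManinUnitSigmaCarrierBlind
import Summits.BirchSwinnertonDyer.BirchSwinnertonDyer.Theorems.TameQuarticManinParityTprimeHeegnerUpperOfManinUnitMonoCarrier
import HarnessLib

/-!
# Crux X₄ `TprimeHeegnerUpperOfManinUnit` (stmt-BirchSwinnertonDyer-23738; TQMP r4 / TQS r303), line `rows_of_manin_unit` v2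
# (3c59fc8b80b3), research stub Σ `stub_sigmaIrreducibleOptimalRows`: the carrier-blind reading S2♭ WITHOUT the reading S2′ —
# from THREE NAMED LITERATURE FACTS {Gross 1991 Prop. 3.7 (2), Poitou–Tate, [GZ86 III (3.1)] image-free} under the one row
# guard «`2` Zhang–Kolyvagin for `(E, K, p)` ⇒ `ρ̄_{E,p}` onto» (free when `2` splits in `K`), hence the typed upper half at `3`
# on ALL irreducible mono-carrier (t′) rows with a Manin-clean datum ⟸ PUB + the three facts + L₀ — NO reading stub

HONEST FRAMING. Theorems only; helper file (`--supports stmt-BirchSwinnertonDyer-23738 --as helper`, leafhand `leafhand-bsd-tamequarticmaninpa-5`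
g0, 2026-08-31); no definition, no named fact, no `sorry`; CONDITIONAL on every displayed input; nothing booked, no stub closed BY NAME, no
item closed, BSD proved for no curve. Sixth file of this seat. WHY: cell bsd-potss's `…JetchevIrreducibleSwapNodeTwoGuard` (k9-c4) proved
S2 of crux 20165 at ONE ROW WITHOUT McCallum's Prop. 5.2 reading — level raising at minimal depth by Kolyvagin's prime-swap walk
(`JetchevIrreducibleSwap.levelRaising_of_h47row_of_poitouTate_of_GZ31_of_irreducible`) under the guard «`2` Kolyvagin ⇒ onto» (Gross 3.7 (2)
as typed admits the Kolyvagin prime `2` only in Gross's surjective setting); and `2` is never a Kolyvagin prime in a Heegner field in which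
`2` SPLITS (`JetchevIrreducibleSwapAtP.not_isKolyvaginPrime_two_of_heegnerHypothesis_two`) — which is exactly the Friedberg–Hoffstein field
the (t′) socket p823764 §3 chooses. Combined with this seat's carrier-blind node (`…SigmaCarrierBlind` §1), the reading stub S2′ leaves
the CRUX's mono-carrier rows entirely:

* §1 `divisibility_of_dvd_level_of_twoGuard_of_namedFacts` — S2♭ (ANY prime `q ∣ N_E`, `s ≤ ord_p c_q`) on a row with the guard, ⟸ the
  three named facts ONLY (bridge `JET.derivedPoint_divisible_of_levelRaising_of_section6_min`; core vertices from
  `coreVertexExistenceIrredP_lt_of_prop37_2_of_poitouTate_of_Gross1991`; `t ≤ m_∞` from `JetchevIrreducibleCarrierBlind.tamagawaExponent_le_mInf_of_dvd_level`).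
* §2 `pDiv_of_dvd_level_of_heegnerFrame_twoSplit_of_namedFacts` — on a Heegner frame `(Dt, H.β, ι, P)` in a field where `2` splits:
  `Koly.PDiv d p s` for `s ≤ ord_p c_q(E)`, ANY `q ∣ N_E`, ⟸ the three facts ONLY.
* §3 `tprime_upper_three_of_irreducible_of_sigmaAtDatumTwoSplit_of_lowerRankZero` — p823764's Σ-at-datum socket with the Σ-input asked
  ONLY in Heegner fields where `2` splits (the socket's own Friedberg–Hoffstein field has this; proof = p823764 §3 verbatim, one binder more).
* §4 `tprime_upper_three_of_irreducible_carrier_of_namedFacts_of_lowerRankZero` — `Typed.MissingUpperBoundAt W 3` on EVERY irreducible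
  mono-carrier (t′) row (carrier of ANY reduction type, image onto OR not) with a Manin-clean datum ⟸ PUB + three named facts + L₀;
  §5 `irreducibleRows_monoCarrier_of_pub_of_namedFacts_of_tameLowerHalfRankZero` — r₁/r₂ binder form ⟸ PUB + three facts + KT 19981.
ACCOUNTING for the crux on the irreducible rows after this file: mono-carrier ⟹ PRINT + L₀ (no research, no reading); ≥ 2 Tamagawa-`3`
carriers ⟹ Σ⁺ (research) + PRINT + L₀. (Σ as a STATEMENT over all Heegner fields still uses S2′ or the guard on the frames with `2` inert,
`2 ∤ N_E`, `a₂ = 0`, `ρ̄₃` not onto — irrelevant for the upper bound.)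
References: [cite: Jetchev2008, Thm. 1.4 (ii) and proof (p. 824), Prop. 5.3, Thm. 5.2, Rem. 6.2] [cite: McCallumLMS1991, §4 Prop. 4.4, §5 proof of Prop. 5.2]
[cite: GrossLMS1991, §3 (3.3), Prop. 3.7 (2), §6 p. 245] [cite: GrossZagier1986, III (3.1), Thm. I.(6.3), (7.3)] [cite: WZhang2014, Notations (xii)]
[cite: MatarNekovar2019, Thm. 0.7 (p. 456), §0.11] [cite: FriedbergHoffstein1995, Thm. B] [cite: Miller2011LMS, Def. 1.1] [cite: Kato2004Asterisque, Thm. 17.4].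
presearch (D-0021): `lean search 'TwoGuard|heegnerHypothesis_two'` → potss k9-c4's row node (carrier `q ∥ N`, `q ≠ p` in the statement) and its
guard lemmas; no carrier-blind / (t′) instance. Pure composition of tree theorems.
-/

set_option autoImplicit false
-- D-0017: single-problem summit, so `Summit.BirchSwinnertonDyer.BirchSwinnertonDyer.…` repeats a namespace BY DESIGN.
set_option linter.dupNamespace false

noncomputable section

open scoped Classical NumberField Pointwise

open WeierstrassCurve IsDedekindDomain NumberField Field Literature Literature.NumberTheory.EllipticCurves
  Literature.NumberTheory.EllipticCurves.ModularForms Literature.NumberTheory.EllipticCurves.Jetchev2008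
  Literature.NumberTheory.EllipticCurves.Rank1Residual
  Literature.NumberTheory.EllipticCurves.Rank1Residual.Typed
  Literature.NumberTheory.EllipticCurves.KrizLi2019 Literature.NumberTheory.QuadraticFields
  Literature.NumberTheory.GaloisRepresentations Literature.NumberTheory.GaloisCohomology
  Literature.NumberTheory.GaloisRepresentations.DiscreteGaloisModule
  Summit.BirchSwinnertonDyer.Rank1Residual Summit.BirchSwinnertonDyer.Rank1Residual.Additive
  Summit.BirchSwinnertonDyer.Rank1Residual.X11b Summit.BirchSwinnertonDyer.Rank1Residual.X11b.Three
  Summit.BirchSwinnertonDyer.Rank1Residual.JET Summit.BirchSwinnertonDyer.Rank1Residual.JET.SelmerVocabulary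
  Literature.NumberTheory.Automorphic
  Summit.BirchSwinnertonDyer.BirchSwinnertonDyer.Theses
  Summit.BirchSwinnertonDyer.BirchSwinnertonDyer.Theorems
  Summit.BirchSwinnertonDyer.BirchSwinnertonDyer.Theorems.SchneiderFree
  Summit.BirchSwinnertonDyer.BirchSwinnertonDyer.Theorems.RamifiedPairUpperBound
  Summit.BirchSwinnertonDyer.BirchSwinnertonDyer.Theorems.JetchevIrreducibleCoreVertex
  Summit.BirchSwinnertonDyer.BirchSwinnertonDyer.Theorems.JetchevIrreducibleSwapAtP

namespace Summit.BirchSwinnertonDyer.BirchSwinnertonDyer.Theorems.JetchevIrreducibleCarrierBlind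

/-! ## §1 S2♭ WITHOUT S2′: three named facts + the row guard «2 Kolyvagin ⇒ onto» -/

/-- **S2♭ from THREE NAMED LITERATURE FACTS under the row guard.** For `E/ℚ` non-CM globally minimal, `K` imaginary quadratic with
`d_K ∉ {−3, −4}` and Heegner for `N_E`, `p` odd, `E[p]` irreducible, `p ∣ N_E`, the ROW GUARD «if `2` is a Zhang–Kolyvagin prime for
`(E, K, p)` then `ρ̄_{E,p}` is onto» (free when `2` splits in `K`, when `2 ∣ N_E`, when `a₂ ≠ 0`, when `p ≠ 3`, or on the onto rows), a frame
`(Dt, β, ι)` whose conductor-`1` derived point is non-torsion, ANY prime `q ∣ N_E` and `s ≤ ord_p c_q(E)`: `p^s ∣ P_n` in `E(K[n])` for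
every `n` squarefree of Kolyvagin primes of index `≥ s`. NAMED FACTS ONLY: `h37` Gross 1991 Prop. 3.7 (2), `hPT` Poitou–Tate, `hF1` [GZ86 III (3.1)]
image-free — NO McCallum Prop. 5.2 reading. Proof: level raising at minimal depth at this frame (the swap walk,
`JetchevIrreducibleSwap.levelRaising_of_h47row_of_poitouTate_of_GZ31_of_irreducible` with guard `(· ≠ 2 ∨ ρ̄_p onto)` and the widened
Prop. 4.7 reading `h47PG_of_prop37_2`), pv-2's bridge `JET.derivedPoint_divisible_of_levelRaising_of_section6_min`, core vertices at the
levels `k > m_∞` from `coreVertexExistenceIrredP_lt_of_prop37_2_of_poitouTate_of_Gross1991`, and the carrier-blind node §1 of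
`…SigmaCarrierBlind`. CONDITIONAL on the three facts; nothing asserted.
[cite: Jetchev2008, Thm. 1.4 (ii) and proof (p. 824), Prop. 5.3, Thm. 5.2] [cite: McCallumLMS1991, §5 proof of Prop. 5.2 (pp. 305–306)]
[cite: GrossLMS1991, §3 (3.3), Prop. 3.7 (2), §6 p. 245] [cite: GrossZagier1986, III (3.1)] -/
theorem divisibility_of_dvd_level_of_twoGuard_of_namedFacts
    (h37 : GrossLMS1991.prop37_2_frobeniusCongruence)
    (hPT : ∀ (K : Type) [Field K] [NumberField K], poitouTate_selmerStructure_duality_conj K)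
    (hF1 : Gross1991_heegnerPoint_sub_ratTorsion_mem_E0_imageFree) :
    ∀ (W : WeierstrassCurve ℚ) [W.IsElliptic] [W.IsGloballyMinimal] [NeZero (W.conductorNorm ℤ)],
      ¬ W.HasCM →
      ∀ (K : Type) [Field K] [NumberField K], IsImaginaryQuadratic K →
      NumberField.discr K ≠ -3 → NumberField.discr K ≠ -4 →
      SatisfiesHeegnerHypothesis (W.conductorNorm ℤ) K →
      ∀ (p : ℕ) [Fact p.Prime], p ≠ 2 → W.HasIrreducibleModPGaloisRep p → p ∣ W.conductorNorm ℤ →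
      (Zhang2014.IsKolyvaginPrime (W.conductorNorm ℤ) W K p 2 → W.HasSurjectiveModNGaloisRep p) →
      ∀ (Dt : ModularParametrizationData W (W.conductorNorm ℤ)) (β : ℤ) (ι : K →+* ℂ)
        (d₁ : KolyvaginHeegnerData Dt β ι 1), ¬ IsOfFinAddOrder d₁.derivedPoint →
      ∀ (q : ℕ) [Fact q.Prime], q ∣ W.conductorNorm ℤ →
      ∀ (s : ℕ), s ≤ padicValNat p ((W.baseChange ℚ_[q]).localTamagawaNumber ℤ_[q]) →
      ∀ (n : ℕ) (d : KolyvaginHeegnerData Dt β ι n), Squarefree n →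
        (∀ ℓ ∈ n.primeFactors, Zhang2014.IsKolyvaginPrime (W.conductorNorm ℤ) W K p ℓ ∧
          s ≤ Zhang2014.kolyvaginIndex W p ℓ) →
        ∃ Q : (W.baseChange (ringClassField K ι n)).toAffine.Point,
          ((p ^ s : ℕ) : ℤ) • Q = d.derivedPoint := by
  intro W _ _ _ hcm K _ _ hK hD3 hD4 hH p _ hp2 hirr hpN hR Dt β ι d₁ hy q _ hqN s hs n d hn hℓ
  obtain ⟨τ, hτ⟩ := exists_algEquiv_ne_one_of_isImaginaryQuadratic K hK
  haveI : ∀ k : ℕ, NumberField (ringClassField K ι k) := numberField_ringClassField K hK ι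
  -- [GZ86 III (3.1)] at this frame (guarded image-free schema, fed by name)
  obtain ⟨n', hcop', hGZ'⟩ :=
    HeegnerE0ImageFree.forall_hGZ_of_Gross1991_imageFree hF1 W K hK hD3 hD4 hH p hp2 hirr Dt β ι
  -- level raising at minimal depth at this frame, guard `(· ≠ 2 ∨ ρ̄_p onto)`, widened Prop. 4.7 reading from Gross 3.7 (2)
  have hraise := JetchevIrreducibleSwap.levelRaising_of_h47row_of_poitouTate_of_GZ31_of_irreducible W hK hD3 hD4 hH
    hcm τ hτ p hp2 hirr hpN Dt β ι (fun ℓ ↦ ℓ ≠ 2 ∨ W.HasSurjectiveModNGaloisRep p) (swapGuardOnto_of hR)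
    (addOrderOf_localization_kolyvaginClass_eq_of_h47PG (h47PG_of_prop37_2 h37) W hcm K hK hD3 hD4 hH p hp2 hirr hpN Dt β ι)
    (hPT K) hcop' hGZ'
  have hCVIlt := coreVertexExistenceIrredP_lt_of_prop37_2_of_poitouTate_of_Gross1991 h37 hPT hF1
  refine derivedPoint_divisible_of_levelRaising_of_section6_min W K p Dt β ι
    (padicValNat p ((W.baseChange ℚ_[q]).localTamagawaNumber ℤ_[q])) hraise ?_ s hs n d hn hℓ
  intro mdiv m hchar hmdef mInf hmInf hKoly
  exact ⟨fun k c ↦ mInf < k → Jetchev2008.IsGlobalCoreVertex W K ι τ p k c.1,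
    fun k c hk hmc hMc ↦ by
      by_cases hik : mInf < k
      · obtain ⟨c', hcore, hM', hm'⟩ := exists_coreVertex_of_coreVertexExistenceIrredPlt hCVIlt W hcm K hK hD3
          hD4 hH τ hτ p hp2 hirr hpN Dt β ι d₁ hy mdiv m hchar hmdef mInf k c hk hmc hMc hik
        exact ⟨c', fun _ ↦ hcore, hM', hm'⟩
      · exact ⟨c, fun h ↦ absurd h hik, by rw [add_comm]; exact hMc, le_of_eq hmc⟩,
    fun k c hk hcore hmc hMc htk hik ↦ tamagawaExponent_le_mInf_of_dvd_level h37 hPT hF1 W hcm K hK hD3 hD4 hH τ hτ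
      p hp2 hirr hpN Dt β ι q hqN mdiv m hchar hmdef mInf k c hk (hcore hik) hmc hMc htk hik⟩

end Summit.BirchSwinnertonDyer.BirchSwinnertonDyer.Theorems.JetchevIrreducibleCarrierBlind

namespace Summit.BirchSwinnertonDyer.BirchSwinnertonDyer.Theorems.TprimeHeegnerUpperOfManinUnit

/-! ## §2 On a Heegner frame in a field where `2` splits: the guard is free -/

/-- **S2♭ on a Heegner frame `(Dt, H.β, ι, P)` in a Heegner field in which `2` SPLITS, from the three named facts ONLY.** `W/ℚ` globally
minimal non-CM, `K` imaginary quadratic with `d_K ∉ {−3, −4}`, Heegner for `N_E` AND for `2` (`2` splits, so `2` is not a Kolyvagin prime: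
`not_isKolyvaginPrime_two_of_heegnerHypothesis_two`), `p` odd, `E[p]` irreducible, `p ∣ N_E`, the Heegner point `P` of `Dt` non-torsion,
ANY prime `q ∣ N_E`, `s ≤ ord_p c_q(E)` ⟹ `Koly.PDiv d p s`. NO reading stub. CONDITIONAL; nothing asserted.
[cite: Jetchev2008, Thm. 1.4 (ii) (p. 812)] [cite: GrossLMS1991, Prop. 3.7 (2), §6 p. 245] [cite: WZhang2014, Notations (xii)] -/
theorem pDiv_of_dvd_level_of_heegnerFrame_twoSplit_of_namedFacts
    (h37 : GrossLMS1991.prop37_2_frobeniusCongruence)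
    (hPT : ∀ (K : Type) [Field K] [NumberField K], poitouTate_selmerStructure_duality_conj K)
    (hF1 : Gross1991_heegnerPoint_sub_ratTorsion_mem_E0_imageFree)
    (W : WeierstrassCurve ℚ) [W.IsElliptic] [W.IsGloballyMinimal] [NeZero (W.conductorNorm ℤ)]
    (hCM : ¬ W.HasCM) (K : Type) [Field K] [NumberField K] (hK : IsImaginaryQuadratic K)
    (h3 : NumberField.discr K ≠ -3) (h4 : NumberField.discr K ≠ -4)
    (hHN : SatisfiesHeegnerHypothesis (W.conductorNorm ℤ) K) (h2K : SatisfiesHeegnerHypothesis 2 K)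
    (p : ℕ) [Fact p.Prime] (hp2 : p ≠ 2) (hirr : W.HasIrreducibleModPGaloisRep p) (hpN : p ∣ W.conductorNorm ℤ)
    (Dt : ModularParametrizationData W (W.conductorNorm ℤ))
    (H : HeegnerDatum (W.conductorNorm ℤ) (NumberField.discr K)) (ι : K →+* ℂ) (P : (W.baseChange K).toAffine.Point)
    (hP : WeierstrassCurve.Affine.Point.map ι.toRatAlgHom P = heegnerPointComplex Dt H) (hnt : ¬ IsOfFinAddOrder P)
    (q : ℕ) [Fact q.Prime] (hqN : q ∣ W.conductorNorm ℤ)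
    (s : ℕ) (hs : s ≤ padicValNat p ((W.baseChange ℚ_[q]).localTamagawaNumber ℤ_[q]))
    (n : ℕ) (d : KolyvaginHeegnerData Dt H.β ι n) (hn : Squarefree n)
    (hℓ : ∀ ℓ ∈ n.primeFactors, Zhang2014.IsKolyvaginPrime (W.conductorNorm ℤ) W K p ℓ ∧
      s ≤ Zhang2014.kolyvaginIndex W p ℓ) :
    Koly.PDiv d p s := by
  -- the conductor-`1` Kolyvagin–Heegner datum on the frame, with bottom point `P` (Darmon 3.6 / Shimura, proved)
  obtain ⟨d₁⟩ := exists_kolyvaginHeegnerData_one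
    (phi_heegnerTau_mem_singularModuliField_holds (W.conductorNorm ℤ) W K) hK Dt H.β ι H.dvd_sq_sub
  have hPd : d₁.toGeomPoints d₁.derivedPoint = toGeomPoints (W.baseChange K) P :=
    X11b.KolyvaginBottom.toGeomPoints_derivedPoint_one_eq
      (heegnerPointOfConductor_one_galoisConj_holds (W.conductorNorm ℤ) W K) hK hHN hP d₁ rfl
  have hy₁ : ¬ IsOfFinAddOrder d₁.derivedPoint := by
    intro hfin
    apply hnt
    have h1 : IsOfFinAddOrder (d₁.toGeomPoints d₁.derivedPoint) := d₁.toGeomPoints.isOfFinAddOrder hfin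
    rw [hPd] at h1
    exact (toGeomPoints_injective (W.baseChange K)).isOfFinAddOrder_iff.mp h1
  exact JetchevIrreducibleCarrierBlind.divisibility_of_dvd_level_of_twoGuard_of_namedFacts h37 hPT hF1 W hCM K hK h3 h4 hHN p
    hp2 hirr hpN (fun h2 ↦ absurd h2 (not_isKolyvaginPrime_two_of_heegnerHypothesis_two h2K)) Dt H.β ι d₁ hy₁ q hqN s hs
    n d hn hℓ

/-! ## §3 The Σ-at-datum socket of p823764 with Σ asked only in fields where `2` splits -/

/-- **The upper half on a non-CM (t′) rank-one row with `E[3]` IRREDUCIBLE, from Σ AT ONE DATUM IN HEEGNER FIELDS WHERE `2` SPLITS.**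
= p823764's `tprime_upper_three_of_irreducible_of_sigmaAtDatum_of_lowerRankZero` VERBATIM with ONE more binder handed to the Σ-input:
`SatisfiesHeegnerHypothesis 2 K` — the Friedberg–Hoffstein field the proof chooses (`hFH W hw 2 two_ne_zero 4`) has it. CONDITIONAL; nothing
asserted. [cite: FriedbergHoffstein1995, Thm. B] [cite: MatarNekovar2019, Thm. 0.7 (p. 456)] [cite: GrossZagier1986, Thm. I.(6.3) and (7.3)] -/
theorem tprime_upper_three_of_irreducible_of_sigmaAtDatumTwoSplit_of_lowerRankZero
    (hGZ : ∀ (N : ℕ) [NeZero N] (W : WeierstrassCurve ℚ) (K : Type) [Field K] [NumberField K],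
      gross_zagier N W K)
    (hKo : ∀ (N : ℕ) [NeZero N] (W : WeierstrassCurve ℚ) (K : Type) [Field K] [NumberField K],
      kolyvagin N W K)
    (hGZK : rank_eq_analyticRank_of_analyticRank_le_one) (hmod : hasEntireLFunction_rat)
    (hGZ73 : GrossZagier1986_thm_I_7_3)
    (hMN : MatarNekovar2019.thm07_padicValNat_card_sha_primary_add_le_of_globalDivisibility_of_irreducible)
    (hnf : exists_isNewformOf) (hFH : friedbergHoffstein_exists_heegnerField_splitDivisors_twist_ne_zero)
    (hL0 : ∀ (V : WeierstrassCurve ℚ) [V.IsElliptic] [V.IsGloballyMinimal],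
      ¬ V.HasCM → Addv V 3 → SubTprime V 3 → V.analyticRank = 0 → MissingLowerBoundAt V 3)
    (W : WeierstrassCurve ℚ) [W.IsElliptic] [W.IsGloballyMinimal] [NeZero (W.conductorNorm ℤ)]
    (hCM : ¬ W.HasCM) (hadd : Addv W 3) (hT : SubTprime W 3) (hirr : W.HasIrreducibleModPGaloisRep 3)
    (hr : W.analyticRank = 1) (Dt : ModularParametrizationData W (W.conductorNorm ℤ))
    (hSig : ∀ (K : Type) [Field K] [NumberField K]
      (H : HeegnerDatum (W.conductorNorm ℤ) (NumberField.discr K)) (ι : K →+* ℂ) (P : (W.baseChange K).toAffine.Point),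
      IsImaginaryQuadratic K → SatisfiesHeegnerHypothesis (W.conductorNorm ℤ) K → SatisfiesHeegnerHypothesis 2 K →
      (W.quadraticTwist (NumberField.discr K : ℚ)).entireLFunction 1 ≠ 0 →
      WeierstrassCurve.Affine.Point.map ι.toRatAlgHom P = heegnerPointComplex Dt H → ¬ IsOfFinAddOrder P →
      Odd (NumberField.discr K) →
      ∀ (s' : ℕ), s' ≤ padicValNat 3 W.tamagawaProduct + padicValNat 3 Dt.c.natAbs →
      ∀ (n : ℕ) (d : KolyvaginHeegnerData Dt H.β ι n), Squarefree n →
      (∀ ℓ ∈ n.primeFactors, Zhang2014.IsKolyvaginPrime (W.conductorNorm ℤ) W K 3 ℓ ∧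
        s' ≤ Zhang2014.kolyvaginIndex W 3 ℓ) → Koly.PDiv d 3 s') :
    MissingUpperBoundAt W 3 := by
  -- the sign of the functional equation is `−1` (modularity, `r_an = 1`)
  have hw : W.rootNumber = -1 := by
    rw [WeierstrassCurve.rootNumber_eq_neg_one_pow_analyticRank_of_exists_isNewformOf hnf W, hr]
    norm_num
  -- the Friedberg–Hoffstein field: every `ℓ ∣ N_E` and `ℓ = 2` split, `L(E^{(d_K)},1) ≠ 0`
  obtain ⟨K, _, _, hK, -, hHN, hH2, hLt⟩ := hFH W hw 2 two_ne_zero 4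
  have hodd : Odd (NumberField.discr K) := by
    have h2 : ¬ ((2 : ℕ) : ℤ) ∣ NumberField.discr K :=
      Literature.SatisfiesHeegnerHypothesis.not_dvd_discr hK.1 hH2 Nat.prime_two (dvd_refl 2)
    rw [← Int.not_even_iff_odd, even_iff_two_dvd]
    exact_mod_cast h2
  -- the Heegner datum and the `K`-rational Heegner point of `Dt`
  obtain ⟨β, hβ⟩ := exists_dvd_sq_sub_discr_holds (W.conductorNorm ℤ) K hK hHN
  obtain ⟨H, -⟩ := nonempty_heegnerDatum_holds (W.conductorNorm ℤ) K hK hβ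
  obtain ⟨ι⟩ : Nonempty (K →+* ℂ) := inferInstance
  obtain ⟨P, hP⟩ := heegnerPointComplex_mem_range_map_holds (W.conductorNorm ℤ) W K hK hHN Dt H ι
  -- a globally minimal model of the twist: a non-CM (t′) curve of analytic rank `0`, so `hL0` applies
  have hD0 : (NumberField.discr K : ℚ) ≠ 0 := by exact_mod_cast NumberField.discr_ne_zero K
  haveI hEt : (W.quadraticTwist (NumberField.discr K : ℚ)).IsElliptic := W.isElliptic_quadraticTwist hD0
  obtain ⟨Cd, hCd⟩ := hasGlobalMinimalModel_rat_holds (W.quadraticTwist (NumberField.discr K : ℚ))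
  haveI : (Cd • W.quadraticTwist (NumberField.discr K : ℚ)).IsGloballyMinimal := hCd
  have hrd : (Cd • W.quadraticTwist (NumberField.discr K : ℚ)).analyticRank = 0 := by
    rw [analyticRank_smul]
    exact analyticRank_eq_zero_of_entireLFunction_one_ne_zero _ hLt
  obtain ⟨hCMd, haddd, hTd, -⟩ := tprime_twist_of_heegner W hCM hadd hT K hK hHN hodd
    (Cd • W.quadraticTwist (NumberField.discr K : ℚ)) Cd rfl
  have hlow : MissingLowerBoundAt (Cd • W.quadraticTwist (NumberField.discr K : ℚ)) 3 :=
    hL0 _ hCMd haddd hTd hrd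
  -- the Heegner point is non-torsion (Gross–Zagier), so Σ at this datum is available; p823764 §2 concludes
  have hL0W : W.entireLFunction 1 = 0 := entireLFunction_one_eq_zero_of_analyticRank_eq_one hr
  obtain ⟨-, hderiv⟩ := leadingLCoeff_eq_deriv_of_analyticRank_eq_one hr
  have hLK : LDerivEK W K ≠ 0 := by
    rw [lDerivEK_eq_deriv_mul W K hmod hL0W]; exact mul_ne_zero hderiv hLt
  have hnt : ¬ IsOfFinAddOrder P :=
    (lDerivEK_ne_zero_iff_not_isOfFinAddOrder W (W.conductorNorm ℤ) K (hGZ _ W K) hK hHN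
      ⟨Dt, H, ι, hP⟩).mp hLK
  exact upper_three_of_irreducible_of_globalDivisibility_of_twistLower hGZ hKo hGZK hmod hGZ73 hMN W hCM hadd hirr hr
    K Dt H ι P (Cd • W.quadraticTwist (NumberField.discr K : ℚ)) hK hodd hHN hLt hP ⟨Cd, rfl⟩
    (fun s' hs' n d hn hℓ ↦ hSig K H ι P hK hHN hH2 hLt hP hnt hodd s' hs' n d hn hℓ) hlow

/-! ## §4 The typed upper half on EVERY irreducible mono-carrier (t′) row with a Manin-clean datum ⟸ PUB + three facts + L₀ -/

/-- **`Typed.MissingUpperBoundAt W 3` ON EVERY IRREDUCIBLE MONO-CARRIER (t′) ROW WITH A MANIN-CLEAN DATUM ⟸ PUB + three named facts + L₀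
— NO reading stub, image onto OR not, carrier of ANY reduction type.** Data: `W/ℚ` globally minimal, non-CM, additive (t′) at `3`, `E[3]`
irreducible, `r_an(W) = 1`; a prime `q ∣ N_E` with `ord₃ ∏_ℓ c_ℓ(E) ≤ ord₃ c_q(E)`; a datum `Dt` at level `N_E` with `3 ∤ c(Dt)`. DISPLAYED:
PUB (`hGZ hKo hGZK hmod hGZ73 hMN hnf hFH`), the named facts `h37 hPT hF1`, and `hL0` (the non-CM (t′) rank-ZERO lower half at `3`). Proof: §3
with Σ at `Dt` in the `2`-split field supplied by §2 (`d_K ≠ −3`: `3 ∣ N_E` splits; `d_K ≠ −4`: `d_K` odd). Supersedes p824349 §2 (27492 BY NAME,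
multiplicative carrier), this seat's `…SigmaMonoCarrierRows` §3 (S2′) and `…SigmaOntoMonoCarrier` §3 (onto). CONDITIONAL; nothing asserted.
[cite: Jetchev2008, Thm. 1.4 (p. 812)] [cite: GrossLMS1991, Prop. 3.7 (2), §6 p. 245] [cite: MatarNekovar2019, Thm. 0.7 (p. 456), §0.11]
[cite: FriedbergHoffstein1995, Thm. B] [cite: Miller2011LMS, Def. 1.1] -/
theorem tprime_upper_three_of_irreducible_carrier_of_namedFacts_of_lowerRankZero
    (hGZ : ∀ (N : ℕ) [NeZero N] (W : WeierstrassCurve ℚ) (K : Type) [Field K] [NumberField K],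
      gross_zagier N W K)
    (hKo : ∀ (N : ℕ) [NeZero N] (W : WeierstrassCurve ℚ) (K : Type) [Field K] [NumberField K],
      kolyvagin N W K)
    (hGZK : rank_eq_analyticRank_of_analyticRank_le_one) (hmod : hasEntireLFunction_rat)
    (hGZ73 : GrossZagier1986_thm_I_7_3)
    (hMN : MatarNekovar2019.thm07_padicValNat_card_sha_primary_add_le_of_globalDivisibility_of_irreducible)
    (hnf : exists_isNewformOf) (hFH : friedbergHoffstein_exists_heegnerField_splitDivisors_twist_ne_zero)
    (h37 : GrossLMS1991.prop37_2_frobeniusCongruence)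
    (hPT : ∀ (K : Type) [Field K] [NumberField K], poitouTate_selmerStructure_duality_conj K)
    (hF1 : Gross1991_heegnerPoint_sub_ratTorsion_mem_E0_imageFree)
    (hL0 : ∀ (V : WeierstrassCurve ℚ) [V.IsElliptic] [V.IsGloballyMinimal],
      ¬ V.HasCM → Addv V 3 → SubTprime V 3 → V.analyticRank = 0 → MissingLowerBoundAt V 3)
    (W : WeierstrassCurve ℚ) [W.IsElliptic] [W.IsGloballyMinimal] [NeZero (W.conductorNorm ℤ)]
    (hCM : ¬ W.HasCM) (hadd : Addv W 3) (hT : SubTprime W 3) (hirr : W.HasIrreducibleModPGaloisRep 3)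
    (hr : W.analyticRank = 1)
    (q : ℕ) [Fact q.Prime] (hqN : q ∣ W.conductorNorm ℤ)
    (hmono : padicValNat 3 W.tamagawaProduct ≤ padicValNat 3 ((W.baseChange ℚ_[q]).localTamagawaNumber ℤ_[q]))
    (Dt : ModularParametrizationData W (W.conductorNorm ℤ)) (hc : ¬ (3 : ℤ) ∣ Dt.c) :
    MissingUpperBoundAt W 3 := by
  have h3N : 3 ∣ W.conductorNorm ℤ :=
    (W.dvd_conductorNorm_iff_not_hasGoodReductionAtPrime 3).mpr (not_good_of_addv W 3 hadd)
  have hc0 : padicValNat 3 Dt.c.natAbs = 0 :=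
    padicValNat.eq_zero_of_not_dvd fun h ↦ hc (Int.ofNat_dvd_left.mpr h)
  refine tprime_upper_three_of_irreducible_of_sigmaAtDatumTwoSplit_of_lowerRankZero hGZ hKo hGZK hmod hGZ73 hMN hnf hFH hL0
    W hCM hadd hT hirr hr Dt ?_
  intro K _ _ H ι P hK hHN h2K _ hP hnt hodd s' hs' n d hn hℓ
  -- `d_K ∉ {-3, -4}`: `3 ∣ N_E` splits in `K`, `d_K` odd
  have h3 : NumberField.discr K ≠ -3 := by
    intro h
    exact (X11b.Three.not_dvd_discr_and_not_dvd_torsionOrder_of_heegner hK hHN (by decide) h3N).1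
      (h ▸ ⟨-1, by norm_num⟩)
  have h4 : NumberField.discr K ≠ -4 := by
    intro h
    rw [h] at hodd
    exact (Int.not_odd_iff_even.mpr ⟨-2, by norm_num⟩) hodd
  have hsq : s' ≤ padicValNat 3 ((W.baseChange ℚ_[q]).localTamagawaNumber ℤ_[q]) := by omega
  exact pDiv_of_dvd_level_of_heegnerFrame_twoSplit_of_namedFacts h37 hPT hF1 W hCM K hK h3 h4 hHN h2K 3 (by decide) hirr h3N
    Dt H ι P hP hnt q hqN s' hsq n d hn hℓ

/-! ## §5 In the binders of the irreducible-row stubs: ALL mono-carrier rows ⟸ PUB + three named facts + KT 19981 -/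

/-- **The irreducible (t′) rank-one rows ON ALL MONO-CARRIER ROWS from PUB + three named facts + KT 19981, by name — NO reading stub.**
For every non-CM (t′) rank-one `W` with `E[3]` irreducible such that some prime `q ∣ N_E` (any reduction type) carries the whole `3`-part of
`∏_ℓ c_ℓ(E)`, and every datum `D` at level `N_E` with `3 ∤ c(D)`: `Typed.MissingUpperBoundAt W 3` ⟸ printed named facts {Gross–Zagier,
Kolyvagin, GZK, GZ I.(7.3), Matar–Nekovář Thm. 0.7, newform, Friedberg–Hoffstein, Gross 3.7 (2), Poitou–Tate, GZ86 III (3.1)} + route KT's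
item `TameLowerHalfRankZero` (19981, BY NAME). The research content of the crux on the irreducible rows is therefore confined to the rows
with ≥ 2 Tamagawa-`3` carriers (Σ⁺). CONDITIONAL; closes nothing. [cite: Jetchev2008, Thm. 1.4 and Cor. 1.5 (p. 812)]
[cite: GrossLMS1991, Prop. 3.7 (2), §6] [cite: MatarNekovar2019, Thm. 0.7 (p. 456), §0.11 (p. 457)] [cite: Kato2004Asterisque, Thm. 17.4] -/
theorem irreducibleRows_monoCarrier_of_pub_of_namedFacts_of_tameLowerHalfRankZero
    (hGZ : ∀ (N : ℕ) [NeZero N] (W : WeierstrassCurve ℚ) (K : Type) [Field K] [NumberField K],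
      gross_zagier N W K)
    (hKo : ∀ (N : ℕ) [NeZero N] (W : WeierstrassCurve ℚ) (K : Type) [Field K] [NumberField K],
      kolyvagin N W K)
    (hGZK : rank_eq_analyticRank_of_analyticRank_le_one) (hGZ73 : GrossZagier1986_thm_I_7_3)
    (hMN : MatarNekovar2019.thm07_padicValNat_card_sha_primary_add_le_of_globalDivisibility_of_irreducible)
    (hnf : exists_isNewformOf) (hFH : friedbergHoffstein_exists_heegnerField_splitDivisors_twist_ne_zero)
    (h37 : GrossLMS1991.prop37_2_frobeniusCongruence)
    (hPT : ∀ (K : Type) [Field K] [NumberField K], poitouTate_selmerStructure_duality_conj K)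
    (hF1 : Gross1991_heegnerPoint_sub_ratTorsion_mem_E0_imageFree)
    (hKT : KatoDescentTamePotSupersingular.TameLowerHalfRankZero) :
    ∀ (W : WeierstrassCurve ℚ) [W.IsElliptic] [W.IsGloballyMinimal] [NeZero (W.conductorNorm ℤ)],
      ¬ W.HasCM → Rank1Residual.Addv W 3 → Summit.BirchSwinnertonDyer.Rank1Residual.Additive.SubTprime W 3 →
      W.HasIrreducibleModPGaloisRep 3 → W.analyticRank = 1 →
      (∃ (q : ℕ) (_ : Fact q.Prime), q ∣ W.conductorNorm ℤ ∧
        padicValNat 3 W.tamagawaProduct ≤ padicValNat 3 ((W.baseChange ℚ_[q]).localTamagawaNumber ℤ_[q])) →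
      ∀ (D : ModularParametrizationData W (W.conductorNorm ℤ)), ¬ (3 : ℤ) ∣ D.maninConstant →
        Rank1Residual.Typed.MissingUpperBoundAt W 3 := by
  intro W _ _ _ hCM hadd hT hirr hr hrow D hc
  obtain ⟨q, hq, hqN, hmono⟩ := hrow
  exact tprime_upper_three_of_irreducible_carrier_of_namedFacts_of_lowerRankZero hGZ hKo hGZK
    (hasEntireLFunction_rat_of_exists_isNewformOf hnf) hGZ73 hMN hnf hFH h37 hPT hF1
    (tprimeLowerRankZero_three_of_tameLowerHalfRankZero hKT) W hCM hadd hT hirr hr q hqN hmono D hc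

end Summit.BirchSwinnertonDyer.BirchSwinnertonDyer.Theorems.TprimeHeegnerUpperOfManinUnit

end
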